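import Summits.PneNP.PneNP.Theorems.BruckRyserSosSosBlindPlanesIdentities
import Summits.PneNP.PneNP.Theorems.BruckRyserSosSosBlindPlanesSpectral
import Literature.Computability.MetaComplexity.SumOfSquares

/-!
# PneNP / BruckRyserSos — the moment functional of a table and its pseudoexpectation properties

Route `PneNP/BruckRyserSos`, crux stmt-PneNP-16761 (`SosBlindPlanes`), sixth file.

From a table `μ` on the template grid we build the linear functional `Efun v D μ` on
`MvPolynomial ℕ ℝ` (the tree's carrier for pseudoexpectations, Kothari–Mori–O'Donnell–Witmer
Def. 2.7): the monomial `X^m` is sent to the template moment of the set of board cells it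
mentions (`cellsOf v m`, the cell `(p, B)` being the indeterminate `X (p v + B)` of the route file)
if all its indeterminates are board cells, and to `0` otherwise. This is the multilinear
(Boolean) reduction followed by the symmetric pseudo-moments. We prove:

* `Efun_boolAxiom_mul` — Booleanity `x² = x` holds in every degree (the value of a monomial only
  depends on its support);
* (file `…FunctionalIds`) `E(p²) = cᵀ M c` for the moment matrix `M`, and the values of the
  design identities times a monomial as the board sums of file `…Identities`.

References: Kothari–Mori–O'Donnell–Witmer (STOC 2017), Defs. 2.7–2.8; M. Laurent, Math. Oper.
Res. 28 (2003) (moment matrices of 0/1 problems: multilinear reduction).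
-/

set_option linter.dupNamespace false -- `Summit.PneNP.PneNP.…`: summit = sub-problem name (D-0017 single-conjunct layout)

noncomputable section

namespace Summit.PneNP.PneNP.Theorems.SosBlindPlanes

open Finset Function MvPolynomial Matrix
open Literature.Computability.MetaComplexity

variable {v D : ℕ}

/-! ### Board cells as indeterminates -/

/-- The indeterminate index of the cell `(p, B)`: `p v + B` (the route file's `x_(p,B)`).
[folklore] -/
def cellIx (c : Fin v × Fin v) : ℕ :=
  c.1.val * v + c.2.val

/-- `cellIx` is injective. [folklore] -/
theorem cellIx_inj : Function.Injective (cellIx (v := v)) := by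
  rintro ⟨p, B⟩ ⟨p', B'⟩ h
  simp only [cellIx] at h
  have hB := B.2
  have hB' := B'.2
  have hv : 0 < v := by omega
  have h1 : p.val = p'.val := by
    have e1 : (B.val + p.val * v) / v = p.val := by
      rw [Nat.add_mul_div_right _ _ hv, Nat.div_eq_of_lt hB, zero_add]
    have e2 : (B'.val + p'.val * v) / v = p'.val := by
      rw [Nat.add_mul_div_right _ _ hv, Nat.div_eq_of_lt hB', zero_add]
    rw [← e1, ← e2, add_comm, h, add_comm]
  have h2 : B.val = B'.val := by
    rw [h1] at h; omega
  exact Prod.ext (Fin.ext h1) (Fin.ext h2)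

/-- Cell indices are `< v²`. [folklore] -/
theorem cellIx_lt (c : Fin v × Fin v) : cellIx c < v * v := by
  have h1 := c.1.2
  have h2 := c.2.2
  simp only [cellIx]
  nlinarith

/-- The board cells mentioned by a monomial (exponent vector) `m`. [folklore] -/
def cellsOf (v : ℕ) (m : ℕ →₀ ℕ) : Finset (Fin v × Fin v) :=
  univ.filter fun c => cellIx c ∈ m.support

/-- A monomial is GOOD if all its indeterminates are board cells. [folklore] -/
def Good (v : ℕ) (m : ℕ →₀ ℕ) : Prop :=
  ∀ i ∈ m.support, i < v * v

/-- Goodness of a monomial is decidable. [folklore] -/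
instance (v : ℕ) : DecidablePred (Good v) :=
  fun m => inferInstanceAs (Decidable (∀ i ∈ m.support, i < v * v))

/-- Membership in `cellsOf`. [folklore] -/
theorem mem_cellsOf {m : ℕ →₀ ℕ} {c : Fin v × Fin v} : c ∈ cellsOf v m ↔ cellIx c ∈ m.support := by
  simp [cellsOf]

/-- A monomial mentions at most as many cells as indeterminates. [folklore] -/
theorem card_cellsOf_le (m : ℕ →₀ ℕ) : (cellsOf v m).card ≤ m.support.card := by
  refine Finset.card_le_card_of_injOn cellIx (fun c hc => mem_cellsOf.1 hc) ?_
  exact cellIx_inj.injOn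

/-- A monomial has at most as many indeterminates as its degree. [folklore] -/
theorem support_card_le_degree (m : ℕ →₀ ℕ) : m.support.card ≤ m.sum fun _ e => e := by
  rw [Finsupp.sum, card_eq_sum_ones]
  exact sum_le_sum fun i hi => Nat.one_le_iff_ne_zero.2 (Finsupp.mem_support_iff.1 hi)

/-- The monomials of a polynomial of total degree `≤ t` mention at most `t` cells. [folklore] -/
theorem card_cellsOf_le_of_mem_support {p : MvPolynomial ℕ ℝ} {t : ℕ} (hp : p.totalDegree ≤ t)
    {m : ℕ →₀ ℕ} (hm : m ∈ p.support) : (cellsOf v m).card ≤ t :=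
  (card_cellsOf_le m).trans ((support_card_le_degree m).trans ((le_totalDegree hm).trans hp))

/-- The support of a sum of exponent vectors. [folklore] -/
theorem support_add_eq (m m' : ℕ →₀ ℕ) : (m + m').support = m.support ∪ m'.support := by
  ext i
  simp only [Finsupp.mem_support_iff, Finsupp.add_apply, mem_union, ne_eq]
  omega

/-- Cells of a product of monomials. [folklore] -/
theorem cellsOf_add (m m' : ℕ →₀ ℕ) : cellsOf v (m + m') = cellsOf v m ∪ cellsOf v m' := by
  ext c
  simp only [mem_cellsOf, support_add_eq, mem_union]

/-- Goodness of a product of monomials. [folklore] -/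
theorem good_add_iff (m m' : ℕ →₀ ℕ) : Good v (m + m') ↔ Good v m ∧ Good v m' := by
  simp only [Good, support_add_eq, mem_union]
  constructor
  · intro h; exact ⟨fun i hi => h i (Or.inl hi), fun i hi => h i (Or.inr hi)⟩
  · rintro ⟨h1, h2⟩ i (hi | hi)
    exacts [h1 i hi, h2 i hi]

/-- The support after adding a single exponent. [folklore] -/
theorem support_add_single (m : ℕ →₀ ℕ) (i : ℕ) {k : ℕ} (hk : k ≠ 0) :
    (m + Finsupp.single i k).support = insert i m.support := by
  rw [support_add_eq, Finsupp.support_single i hk, union_comm]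
  simp

/-- Cells after multiplying by a power of a cell indeterminate. [folklore] -/
theorem cellsOf_add_single (m : ℕ →₀ ℕ) (c : Fin v × Fin v) {k : ℕ} (hk : k ≠ 0) :
    cellsOf v (m + Finsupp.single (cellIx c) k) = insert c (cellsOf v m) := by
  ext c'
  simp only [mem_cellsOf, support_add_single m _ hk, mem_insert, cellIx_inj.eq_iff]

/-- Goodness after multiplying by a power of a cell indeterminate. [folklore] -/
theorem good_add_single_iff (m : ℕ →₀ ℕ) (c : Fin v × Fin v) {k : ℕ} (hk : k ≠ 0) :
    Good v (m + Finsupp.single (cellIx c) k) ↔ Good v m := by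
  simp only [Good, support_add_single m _ hk, mem_insert, forall_eq_or_imp]
  exact ⟨fun h => h.2, fun h => ⟨cellIx_lt c, h⟩⟩

/-! ### The functional -/

/-- The WEIGHT of a monomial: the template moment of its cells if it is good, else `0`.
[folklore] -/
def wt (v D : ℕ) (μ : Finset (Fin D × Fin D) → ℝ) (m : ℕ →₀ ℕ) : ℝ :=
  if Good v m then tmom D μ (cellsOf v m) else 0

/-- The weight of a good monomial. [folklore] -/
theorem wt_of_good {μ : Finset (Fin D × Fin D) → ℝ} {m : ℕ →₀ ℕ} (h : Good v m) :
    wt v D μ m = tmom D μ (cellsOf v m) := by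
  simp [wt, h]

/-- The weight of a monomial that is not good. [folklore] -/
theorem wt_of_not_good {μ : Finset (Fin D × Fin D) → ℝ} {m : ℕ →₀ ℕ} (h : ¬ Good v m) :
    wt v D μ m = 0 := by
  simp [wt, h]

/-- **The moment functional of a table**: the linear functional on real polynomials sending the
monomial `X^m` to the weight of `m` (multilinear reduction followed by the symmetric
pseudo-moments). [Kothari–Mori–O'Donnell–Witmer 2017, Def. 2.7; Laurent 2003] [folklore] -/
def Efun (v D : ℕ) (μ : Finset (Fin D × Fin D) → ℝ) : MvPolynomial ℕ ℝ →ₗ[ℝ] ℝ :=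
  (MvPolynomial.basisMonomials ℕ ℝ).constr ℝ (wt v D μ)

/-- The functional on a monomial. [folklore] -/
theorem Efun_monomial (μ : Finset (Fin D × Fin D) → ℝ) (m : ℕ →₀ ℕ) (a : ℝ) :
    Efun v D μ (monomial m a) = a * wt v D μ m := by
  have h1 : monomial m a = a • (MvPolynomial.basisMonomials ℕ ℝ) m := by
    rw [MvPolynomial.coe_basisMonomials, smul_monomial, smul_eq_mul, mul_one]
  rw [h1, map_smul, Efun, (MvPolynomial.basisMonomials ℕ ℝ).constr_basis, smul_eq_mul]

/-- The functional on a polynomial, coefficientwise. [folklore] -/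
theorem Efun_eq_sum (μ : Finset (Fin D × Fin D) → ℝ) (p : MvPolynomial ℕ ℝ) :
    Efun v D μ p = ∑ m ∈ p.support, coeff m p * wt v D μ m := by
  conv_lhs => rw [p.as_sum, map_sum]
  exact sum_congr rfl fun m _ => Efun_monomial μ m _

/-- `E 1 = μ ∅`. [folklore] -/
theorem Efun_one (μ : Finset (Fin D × Fin D) → ℝ) (hD : 0 < D) : Efun v D μ 1 = μ ∅ := by
  rw [← C_1, C_apply, Efun_monomial, one_mul, wt_of_good (fun i hi => by simp at hi)]
  have h0 : cellsOf v (0 : ℕ →₀ ℕ) = ∅ := by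
    ext c; simp [mem_cellsOf]
  rw [h0, tmom_of_card_le (by simp)]
  obtain ⟨f, g, -, -, hc⟩ := canon_spec hD (U := (∅ : Finset (Fin v × Fin v))) (by simp) (by simp)
  rw [hc, rel_empty]

/-! ### Booleanity -/

/-- **Booleanity**: `E ((x_w² - x_w) r) = 0` for every `w` and every polynomial `r`. [folklore] -/
theorem Efun_boolAxiom_mul (μ : Finset (Fin D × Fin D) → ℝ) (w : ℕ) (r : MvPolynomial ℕ ℝ) :
    Efun v D μ (boolAxiom w * r) = 0 := by
  rw [r.as_sum, mul_sum, map_sum]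
  refine sum_eq_zero fun m _ => ?_
  rw [boolAxiom, sub_mul, map_sub, X_pow_eq_monomial, X, monomial_mul, monomial_mul, Efun_monomial,
    Efun_monomial, sub_eq_zero]
  simp only [one_mul]
  -- the two monomials have the same support
  have hs : (Finsupp.single w 2 + m).support = (Finsupp.single w 1 + m).support := by
    rw [add_comm, support_add_single m w (by norm_num), add_comm, support_add_single m w (by norm_num)]
  have hg : Good v (Finsupp.single w 2 + m) ↔ Good v (Finsupp.single w 1 + m) := by
    simp only [Good, hs]
  have hc : cellsOf v (Finsupp.single w 2 + m) = cellsOf v (Finsupp.single w 1 + m) := by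
    ext c; simp only [mem_cellsOf, hs]
  by_cases h : Good v (Finsupp.single w 1 + m)
  · rw [wt_of_good (hg.2 h), wt_of_good h, hc]
  · rw [wt_of_not_good (fun h' => h (hg.1 h')), wt_of_not_good h]

end Summit.PneNP.PneNP.Theorems.SosBlindPlanes
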